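import Summits.BirchSwinnertonDyer.BirchSwinnertonDyer.Theorems.AlignedTransportAtTwoBSDOfMainConjectureRankOneAtTwoEulerCharAtTwo
import HarnessLib

/-!
# Route `AlignedTransportAtTwo`, crux C3′ `BSDOfMainConjectureRankOneAtTwo` (stmt-BirchSwinnertonDyer-23008) — the `p = 2` DICTIONARY
# «Schneider's three-clause theorem (T-23008-a) ⟺ Coates–Schneider–Sujatha's two-clause `Γ`-Euler-characteristic statement» at `2`

HONEST FRAMING (cell `bsd-f1-sign2`, WIDTH-5 attach seat `bsd-line-att-p4` g6 under the C3′ lead lineage `bsd-line-att-p1`;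
`--supports stmt-BirchSwinnertonDyer-23008 --as helper`). BSD is NOT proved; C3′ is NOT closed; nothing is asserted. THEOREMS ONLY
(no `def`, no named fact, no `sorry`). Companion of `…Theorems.AlignedTransportAtTwoEulerCharAtTwo` (p624996), which treats conjunct (3)
alone (the registered stub `F1Sign2.SchneiderLeadingTermFormulaAtTwoSq`). Here the PARENT cell statement T-23008-a
`F1Sign2.SchneiderLeadingTermAtTwoSq` (p598374; all three clauses of BMS Thm. 1.7 read at `2`: (1) `rank ≤ ord_T f_E`, (2) `ord_T f_E = rank ↔
(Reg₂ ≠ 0 ∧ Ш(2) finite)`, (3) the leading-term formula) is shown EQUIVALENT, per curve and globally, to the FULL two-clause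
`Γ`-Euler-characteristic statement of Coates–Schneider–Sujatha 2003 p. 204 («Case 2», printed for `p ⩾ 5`) READ AT `p = 2` on the Pontryagin-dual
side — exactly the hypothesis `hχ` of the Literature theorem `Schneider1985_order_charGenerator_of_eulerChar` with `5 ≤ p` replaced by `p = 2`
and `IsCanonical` by `IsCanonicalSq`: assuming `Ш(E/ℚ)(2)` finite, (i) `ker φ_X`, `coker φ_X` finite `↔ Reg₂(Dh) ≠ 0`, and (ii) if `Reg₂(Dh) ≠ 0`
then `#coker φ_X·(log₂ 5)^r·#E(ℚ)(2)² = u·#ker φ_X·Reg₂(Dh)·#Ш(2)·2^{v₂(∏c_v)}·#Ẽ(𝔽₂)(2)²`.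

* §1 `schneiderLeadingTermAtTwoSqAt_iff_eulerCharFullAt` (per curve), §2 `schneiderLeadingTermAtTwoSq_iff_eulerCharFull` (global):
  the p = 2 twin of the Literature theorem WITH ITS CONVERSE. Ingredients: clause (1) is a tree theorem at every `p`
  (`mordellWeilRank_le_order_charGenerator`); `ord f_E = rank ↔ ker φ_X` finite given `Ш(2)` finite (p624996 §1, control at `2` = tree
  theorem); `ord f_E = rank ⟹ Ш(2)` finite (squeeze `rank ≤ corank Sel ≤ rank_{ℤ₂} X/TX ≤ ord f_E` + Kummer); (3) ⟺ (ii) by p624996 §2.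
* §3 `schneiderLeadingTermFormulaAtTwoSq_of_eulerCharFull` — the registered stub from the full statement (projection).

So at `p = 2` the cell's two typed Schneider statements and the two CSS clauses are ONE obligation in four spellings; which spelling a line
registers is bookkeeping. Not in print at `2` over `ℚ` in any spelling (CSS p ⩾ 5; Schneider 1985 / Perrin-Riou 1992 `p` odd).

References: [CoatesSchneiderSujatha2003] §3 (30)–(31) p. 199, p. 204; [BalakrishnanMullerStein2015] Thm. 1.7; [Schneider1985] Thm. 2′;
[PerrinRiou1992] §3.4.3; [GreenbergLNM1716] Thm. 1.2.
-/

set_option autoImplicit false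
-- the route's Theorems namespace repeats a component by design (summit = sub-problem, D-0017).
set_option linter.dupNamespace false

noncomputable section

open scoped Classical

open WeierstrassCurve Literature.NumberTheory.EllipticCurves Literature.NumberTheory.EllipticCurves.IwasawaAlgebra
  Literature.NumberTheory.EllipticCurves.Greenberg1999 Summit.BirchSwinnertonDyer.Rank1Residual.F1Sign2
  Summit.BirchSwinnertonDyer.BirchSwinnertonDyer.Theorems.AlignedTransportAtTwoEulerCharAtTwo

namespace Summit.BirchSwinnertonDyer.BirchSwinnertonDyer.Theorems.AlignedTransportAtTwoEulerCharAtTwoDictionary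

/-- `ord_T f_E = rank E(ℚ) ⟹ Ш(E/ℚ)(p)` finite (any good ordinary `p`, cyclotomic datum, finitely generated torsion dual with
`char X = (f_E)`): `rank ≤ corank Sel_{p^∞}(E/ℚ) ≤ rank_{ℤ_p} X/TX ≤ ord f_E = rank` forces `corank Sel = rank`, and
`corank Sel = rank + corank Ш(p)` (Kummer) gives `corank Ш(p) = 0`, i.e. `Ш(p)` finite (`Ш[p]` is finite). The clause-(2) step of
`Schneider1985_order_charGenerator_of_eulerChar`, isolated; no control theorem needed. [cite: BalakrishnanMullerStein2015, Thm. 1.7 (2)]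
[cite: GreenbergLNM1716, §1 p. 65] -/
theorem finite_primaryComponent_sha_of_order_eq_mordellWeilRank (W : WeierstrassCurve ℚ) [W.IsElliptic] [W.IsGloballyMinimal]
    (p : ℕ) [Fact p.Prime] {κ : ZpExtension ℚ p} {γ : Field.absoluteGaloisGroup ℚ} (hγ : κ.IsTopGenerator γ)
    (D : W.SelmerDualData κ γ) [Module.Finite (IwasawaAlgebra p) D.X] (hX : D.IsTorsion) (fE : IwasawaAlgebra p)
    (hchar : D.charIdeal = Ideal.span {fE}) (heq : fE.order = W.mordellWeilRank) :
    Finite (AddCommGroup.primaryComponent W.sha p) := by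
  have hmem : fE ∈ D.charIdeal := hchar ▸ Ideal.mem_span_singleton_self fE
  have hsc : W.selmerCorank p ≤ coinvariantsRank p D.X := W.selmerCorank_le_coinvariantsRank hγ D
  have hco : (coinvariantsRank p D.X : ℕ∞) ≤ fE.order := coinvariantsRank_le_order_of_mem_charIdeal D.X hX fE hmem
  have hkummer : W.selmerCorank p = W.mordellWeilRank + W.shaCorank p := W.selmerCorank_eq_mordellWeilRank_add_holds p
  have hcr : coinvariantsRank p D.X ≤ W.mordellWeilRank := by exact_mod_cast hco.trans_eq heq
  have hsha0 : W.shaCorank p = 0 := by omega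
  exact (finite_primaryComponent_sha_iff_shaCorank_eq_zero W p).mpr hsha0

/-! ## §1 Per curve: T-23008-a at `W` ⟺ the full two-clause Euler-characteristic statement at `W` -/

/-- **Per curve: `SchneiderLeadingTermAtTwoSqAt W ↔` CSS «Case 2» at `2` for `W` (both clauses).** For `W/ℚ` globally minimal: the
three-clause Schneider statement at `2` for `W` (T-23008-a at `W`: for every cyclotomic datum, finitely generated torsion strict dual `X`,
characteristic generator `f_E`, THE `Σ²` height `Dh`: `rank ≤ ord f_E`; `ord f_E = rank ↔ (Reg₂ ≠ 0 ∧ Ш(2) finite)`; the leading-term formula)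
holds IFF for every such datum and `Dh`, ASSUMING `Ш(E/ℚ)(2)` finite: (i) `ker φ_X` and `coker φ_X` are finite `↔ Reg₂(Dh) ≠ 0`, and (ii)
`Reg₂(Dh) ≠ 0 ⟹ #coker φ_X·(log₂ 5)^r·#E(ℚ)(2)² = u·#ker φ_X·Reg₂(Dh)·#Ш(2)·2^{v₂(∏c_v)}·#Ẽ(𝔽₂)(2)²` — the hypothesis `hχ` of
`Schneider1985_order_charGenerator_of_eulerChar` read at `p = 2` over `IsCanonicalSq`. CONDITIONAL on nothing; closes nothing.
[cite: CoatesSchneiderSujatha2003, p. 204 (Case 2), §3 (30)–(31) p. 199] [cite: BalakrishnanMullerStein2015, Thm. 1.7] -/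
theorem schneiderLeadingTermAtTwoSqAt_iff_eulerCharFullAt (W : WeierstrassCurve ℚ) [W.IsElliptic] [W.IsGloballyMinimal] :
    SchneiderLeadingTermAtTwoSqAt W ↔
    (W.HasGoodReductionAtPrime 2 → ¬ (2 : ℤ) ∣ W.frobeniusTrace 2 →
      ∀ (κ : ZpExtension ℚ 2) (γ : Field.absoluteGaloisGroup ℚ),
        κ.IsCyclotomic → κ.IsTopGenerator γ → IsCyclotomicVariable 2 γ →
      ∀ (D : W.SelmerDualData κ γ) [Module.Finite (IwasawaAlgebra 2) D.X], D.IsTorsion →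
      ∀ (Dh : PAdicHeightData W 2), Dh.IsCanonicalSq →
        Finite (AddCommGroup.primaryComponent W.sha 2) →
        ((Finite (LinearMap.ker (bockstein 2 D.X)) ∧
            Finite (coinvariants 2 D.X ⧸ LinearMap.range (bockstein 2 D.X))) ↔
          padicRegulator Dh ≠ 0) ∧
        (padicRegulator Dh ≠ 0 → ∃ u : ℤ_[2]ˣ,
          (Nat.card (coinvariants 2 D.X ⧸ LinearMap.range (bockstein 2 D.X)) : ℚ_[2]) *
              padicLog 2 (cyclotomicGenerator 2) ^ W.mordellWeilRank *
              (Nat.card (AddCommGroup.primaryComponent W.toAffine.Point 2) : ℚ_[2]) ^ 2 =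
            ((u : ℤ_[2]) : ℚ_[2]) * Nat.card (LinearMap.ker (bockstein 2 D.X)) * padicRegulator Dh *
              Nat.card (AddCommGroup.primaryComponent W.sha 2) * (2 : ℚ_[2]) ^ (padicValNat 2 W.tamagawaProduct) *
              (Nat.card (AddCommGroup.primaryComponent
                ((integralModelInt W).map (Int.castRingHom (ZMod 2))).toAffine.Point 2) : ℚ_[2]) ^ 2)) := by
  constructor
  · intro h hg ho κ γ hκ hγ hγ' D _ hX Dh hDh hSha
    obtain ⟨fE, hchar⟩ := (charIdeal_isPrincipal_holds 2 D.X).principal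
    obtain ⟨-, h2, h3⟩ := h hg ho κ γ hκ hγ hγ' D hX fE hchar Dh hDh
    have hA := order_eq_mordellWeilRank_iff_finite_ker_bockstein W 2 ⟨hg, ho⟩ hκ hγ D hX fE hchar hSha
    have hkc := finite_ker_bockstein_iff_finite_coker_bockstein 2 D.X hX
    refine ⟨⟨fun hfin ↦ (h2.mp (hA.mpr hfin.1)).1, fun hS ↦ ?_⟩, fun hS ↦ ?_⟩
    · have hk := hA.mp (h2.mpr ⟨hS, hSha⟩)
      exact ⟨hk, hkc.mp hk⟩
    · exact (eulerChar_of_formula W ⟨hg, ho⟩ hγ D hX fE hchar Dh hS hSha (h3 hS hSha)).2.2.2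
  · intro H hg ho κ γ hκ hγ hγ' D _ hX fE hchar Dh hDh
    have h1 : (W.mordellWeilRank : ℕ∞) ≤ fE.order := W.mordellWeilRank_le_order_charGenerator hγ D hX hchar
    have hkc := finite_ker_bockstein_iff_finite_coker_bockstein 2 D.X hX
    refine ⟨h1, ⟨fun heq ↦ ?_, fun ⟨hS, hSha⟩ ↦ ?_⟩, fun hS hSha ↦ ?_⟩
    · have hSha := finite_primaryComponent_sha_of_order_eq_mordellWeilRank W 2 hγ D hX fE hchar heq
      have hk := (order_eq_mordellWeilRank_iff_finite_ker_bockstein W 2 ⟨hg, ho⟩ hκ hγ D hX fE hchar hSha).mp heq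
      exact ⟨(H hg ho κ γ hκ hγ hγ' D hX Dh hDh hSha).1.mp ⟨hk, hkc.mp hk⟩, hSha⟩
    · have hfin := (H hg ho κ γ hκ hγ hγ' D hX Dh hDh hSha).1.mpr hS
      exact (order_eq_mordellWeilRank_iff_finite_ker_bockstein W 2 ⟨hg, ho⟩ hκ hγ D hX fE hchar hSha).mpr hfin.1
    · obtain ⟨hi, hii⟩ := H hg ho κ γ hκ hγ hγ' D hX Dh hDh hSha
      exact (formula_of_eulerChar W ⟨hg, ho⟩ hκ hγ D hX fE hchar Dh hSha (hi.mpr hS).1 (hii hS)).2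

/-! ## §2 Globally: T-23008-a ⟺ the full two-clause Euler-characteristic statement at `2` -/

/-- **`SchneiderLeadingTermAtTwoSq ↔` CSS «Case 2» READ AT `p = 2` (both clauses, every curve)** — the `p = 2` twin of the Literature
theorem `Schneider1985_order_charGenerator_of_eulerChar` (there: `5 ≤ p`, `IsCanonical`, one direction) WITH ITS CONVERSE: the cell's parent
statement T-23008-a and the two-clause `Γ`-Euler-characteristic statement at `2` are the same obligation. Mazur's control theorem at `2` is
a tree theorem, so — unlike the odd-`p` Literature theorem, which takes `Greenberg1999_coinvariantsRank_eq_selmerCorank_rat` as a hypothesis —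
nothing but the two statements appears. CONDITIONAL on nothing; closes nothing. [cite: CoatesSchneiderSujatha2003, p. 204 (Case 2)]
[cite: BalakrishnanMullerStein2015, Thm. 1.7] [cite: GreenbergLNM1716, Thm. 1.2] -/
theorem schneiderLeadingTermAtTwoSq_iff_eulerCharFull :
    SchneiderLeadingTermAtTwoSq ↔
    ∀ (W : WeierstrassCurve ℚ) [W.IsElliptic] [W.IsGloballyMinimal],
      W.HasGoodReductionAtPrime 2 → ¬ (2 : ℤ) ∣ W.frobeniusTrace 2 →
      ∀ (κ : ZpExtension ℚ 2) (γ : Field.absoluteGaloisGroup ℚ),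
        κ.IsCyclotomic → κ.IsTopGenerator γ → IsCyclotomicVariable 2 γ →
      ∀ (D : W.SelmerDualData κ γ) [Module.Finite (IwasawaAlgebra 2) D.X], D.IsTorsion →
      ∀ (Dh : PAdicHeightData W 2), Dh.IsCanonicalSq →
        Finite (AddCommGroup.primaryComponent W.sha 2) →
        ((Finite (LinearMap.ker (bockstein 2 D.X)) ∧
            Finite (coinvariants 2 D.X ⧸ LinearMap.range (bockstein 2 D.X))) ↔
          padicRegulator Dh ≠ 0) ∧
        (padicRegulator Dh ≠ 0 → ∃ u : ℤ_[2]ˣ,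
          (Nat.card (coinvariants 2 D.X ⧸ LinearMap.range (bockstein 2 D.X)) : ℚ_[2]) *
              padicLog 2 (cyclotomicGenerator 2) ^ W.mordellWeilRank *
              (Nat.card (AddCommGroup.primaryComponent W.toAffine.Point 2) : ℚ_[2]) ^ 2 =
            ((u : ℤ_[2]) : ℚ_[2]) * Nat.card (LinearMap.ker (bockstein 2 D.X)) * padicRegulator Dh *
              Nat.card (AddCommGroup.primaryComponent W.sha 2) * (2 : ℚ_[2]) ^ (padicValNat 2 W.tamagawaProduct) *
              (Nat.card (AddCommGroup.primaryComponent
                ((integralModelInt W).map (Int.castRingHom (ZMod 2))).toAffine.Point 2) : ℚ_[2]) ^ 2) := by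
  rw [schneiderLeadingTermAtTwoSq_iff]
  exact ⟨fun h W _ _ ↦ (schneiderLeadingTermAtTwoSqAt_iff_eulerCharFullAt W).mp (h W),
    fun h W _ _ ↦ (schneiderLeadingTermAtTwoSqAt_iff_eulerCharFullAt W).mpr (h W)⟩

/-! ## §3 The registered stub from the full two-clause statement -/

/-- **Projection: the full two-clause Euler-characteristic statement at `2` ⟹ the registered stub `SchneiderLeadingTermFormulaAtTwoSq`**
(via T-23008-a and `schneiderLeadingTermFormulaAtTwoSq_of_schneiderLeadingTermAtTwoSq`). CONDITIONAL; closes nothing.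
[cite: CoatesSchneiderSujatha2003, p. 204 (Case 2)] [cite: BalakrishnanMullerStein2015, Thm. 1.7 (3)] -/
theorem schneiderLeadingTermFormulaAtTwoSq_of_eulerCharFull
    (hχ : ∀ (W : WeierstrassCurve ℚ) [W.IsElliptic] [W.IsGloballyMinimal],
      W.HasGoodReductionAtPrime 2 → ¬ (2 : ℤ) ∣ W.frobeniusTrace 2 →
      ∀ (κ : ZpExtension ℚ 2) (γ : Field.absoluteGaloisGroup ℚ),
        κ.IsCyclotomic → κ.IsTopGenerator γ → IsCyclotomicVariable 2 γ →
      ∀ (D : W.SelmerDualData κ γ) [Module.Finite (IwasawaAlgebra 2) D.X], D.IsTorsion →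
      ∀ (Dh : PAdicHeightData W 2), Dh.IsCanonicalSq →
        Finite (AddCommGroup.primaryComponent W.sha 2) →
        ((Finite (LinearMap.ker (bockstein 2 D.X)) ∧
            Finite (coinvariants 2 D.X ⧸ LinearMap.range (bockstein 2 D.X))) ↔
          padicRegulator Dh ≠ 0) ∧
        (padicRegulator Dh ≠ 0 → ∃ u : ℤ_[2]ˣ,
          (Nat.card (coinvariants 2 D.X ⧸ LinearMap.range (bockstein 2 D.X)) : ℚ_[2]) *
              padicLog 2 (cyclotomicGenerator 2) ^ W.mordellWeilRank *
              (Nat.card (AddCommGroup.primaryComponent W.toAffine.Point 2) : ℚ_[2]) ^ 2 =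
            ((u : ℤ_[2]) : ℚ_[2]) * Nat.card (LinearMap.ker (bockstein 2 D.X)) * padicRegulator Dh *
              Nat.card (AddCommGroup.primaryComponent W.sha 2) * (2 : ℚ_[2]) ^ (padicValNat 2 W.tamagawaProduct) *
              (Nat.card (AddCommGroup.primaryComponent
                ((integralModelInt W).map (Int.castRingHom (ZMod 2))).toAffine.Point 2) : ℚ_[2]) ^ 2)) :
    SchneiderLeadingTermFormulaAtTwoSq :=
  schneiderLeadingTermFormulaAtTwoSq_of_schneiderLeadingTermAtTwoSq (schneiderLeadingTermAtTwoSq_iff_eulerCharFull.mpr hχ)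

end Summit.BirchSwinnertonDyer.BirchSwinnertonDyer.Theorems.AlignedTransportAtTwoEulerCharAtTwoDictionary

end
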